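import Summits.CriticalPhenomena.PercolationContinuityZ3.Theorems.Transplant.Slab111VBundle
import Summits.CriticalPhenomena.PercolationContinuityZ3.Theorems.Transplant.Slab111VLevels
import HarnessLib

/-!
# The routing certificate for `ShapedLinkage 3 (Slab111.hexShadow k)`, VIII: soundness of the RESIDUE MODEL of the film near a block

builds on p205010 (kernel theorem, internal audit signed; external expert review pending) — NOT used in this file.  Lane `prim-bschramm`, seat
`prim-bschramm-p2` (gen 35; class C1b; memo `HOME/bschramm/P2-LATTICES.md` §129); helper file (`--supports stmt-CriticalPhenomena-4575 --as helper`).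
The need list of «Slab111VSearch» is computed in a RESIDUE MODEL of the film over a block: a vertex is (relative column, extended status), where the
extended status `s` stands for the level `s` (`s ≤ 3`), for any middle level (`s = 9`), or for the level `k − (12 − s)` (`10 ≤ s ≤ 13`); membership in the
cleared set is `Srch.inWs` (block test + peel codes), the window is `Srch.inWinB`, neighbours are `(c ± u, nbrStatus s)`.  This file proves the model
SOUND for the real film (`k ≥ 10`): `rcol`, `adj_model` (film edges move the column by `±u ∈ U` and the level by `±1`), `RepLevel`, **`mem_W_of_inWs`** /
**`inWs_of_mem_W`**, `repLevel_statusOf`, `repLevel_nbr_up/down`, `inWinB_of_inWin`, and the injectivity facts used for the witness conditions.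
[cite: DuminilCopinSidoraviciusTassion2016, §2.3 (proof of Fact 2: u', v', w')]
-/

noncomputable section

namespace Summit.CriticalPhenomena.PercolationContinuityZ3.Theorems.Transplant

open Literature.Probability.Percolation Literature.Probability.LatticeModels SimpleGraph
open scoped Classical

namespace Slab111

variable {k : ℕ}

/-! ## §1 Relative columns and film edges -/

/-- The relative column of a film vertex with respect to the block centre `z`. [folklore] -/
def rcol (z : Site 2) (x : slab111 k) : Col := (sh x 0 - z 0, sh x 1 - z 1)

/-- The shadow is the centre plus the relative column. [folklore] -/
theorem sh_eq_vcol_rcol (z : Site 2) (x : slab111 k) : sh x = vcol z (rcol z x) := by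
  ext i; fin_cases i <;> simp [rcol, vcol]

/-- The relative column is determined by the shadow. [folklore] -/
theorem rcol_eq_of_sh {z : Site 2} {x : slab111 k} {c : Col} (h : sh x = vcol z c) : rcol z x = c := by
  have h0 := congrFun h 0; have h1 := congrFun h 1
  simp only [vcol_apply_zero, vcol_apply_one] at h0 h1
  ext <;> simp [rcol, h0, h1]

/-- **Film edges in the model**: the column moves by an up-direction and the level by `+1`, or the reverse. [folklore] -/
theorem adj_model {z : Site 2} {x y : slab111 k} (h : (film k).Adj x y) :
    ∃ u ∈ Srch.ups, (rcol z y = ((rcol z x).1 + u.1, (rcol z x).2 + u.2) ∧ lev (y : Site 3) = lev (x : Site 3) + 1) ∨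
      (rcol z y = ((rcol z x).1 - u.1, (rcol z x).2 - u.2) ∧ lev (y : Site 3) = lev (x : Site 3) - 1) := by
  have hz : (zdGraph 3).Adj (x : Site 3) (y : Site 3) := h
  obtain ⟨i, hi | hi⟩ := (zdGraph_adj_iff _ _).1 hz
  · have h0 := congrFun hi 0; have h1 := congrFun hi 1; have h2 := congrFun hi 2
    fin_cases i
    · refine ⟨(1, 0), by simp [Srch.ups], Or.inl ⟨?_, ?_⟩⟩
      · simp at h0 h1 h2; refine Prod.ext ?_ ?_ <;> simp only [rcol, sh_apply_zero, sh_apply_one] <;> omega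
      · simp at h0 h1 h2; simp [lev, h0, h1, h2]; ring
    · refine ⟨(0, -1), by simp [Srch.ups], Or.inl ⟨?_, ?_⟩⟩
      · simp at h0 h1 h2; refine Prod.ext ?_ ?_ <;> simp only [rcol, sh_apply_zero, sh_apply_one] <;> omega
      · simp at h0 h1 h2; simp [lev, h0, h1, h2]; ring
    · refine ⟨(-1, 1), by simp [Srch.ups], Or.inl ⟨?_, ?_⟩⟩
      · simp at h0 h1 h2; refine Prod.ext ?_ ?_ <;> simp only [rcol, sh_apply_zero, sh_apply_one] <;> omega
      · simp at h0 h1 h2; simp [lev, h0, h1, h2]; ring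
  · have h0 := congrFun hi 0; have h1 := congrFun hi 1; have h2 := congrFun hi 2
    fin_cases i
    · refine ⟨(1, 0), by simp [Srch.ups], Or.inr ⟨?_, ?_⟩⟩
      · simp at h0 h1 h2; refine Prod.ext ?_ ?_ <;> simp only [rcol, sh_apply_zero, sh_apply_one] <;> omega
      · simp at h0 h1 h2; simp [lev, h0, h1, h2]; ring
    · refine ⟨(0, -1), by simp [Srch.ups], Or.inr ⟨?_, ?_⟩⟩
      · simp at h0 h1 h2; refine Prod.ext ?_ ?_ <;> simp only [rcol, sh_apply_zero, sh_apply_one] <;> omega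
      · simp at h0 h1 h2; simp [lev, h0, h1, h2]; ring
    · refine ⟨(-1, 1), by simp [Srch.ups], Or.inr ⟨?_, ?_⟩⟩
      · simp at h0 h1 h2; refine Prod.ext ?_ ?_ <;> simp only [rcol, sh_apply_zero, sh_apply_one] <;> omega
      · simp at h0 h1 h2; simp [lev, h0, h1, h2]; ring

/-! ## §2 Extended statuses and the cleared set -/

/-- The extended status `s` represents the level `L` (in a film of thickness `k`). [folklore] -/
def RepLevel (k : ℕ) (s : ℤ) (L : ℤ) : Prop := (s ≤ 3 ∧ L = s) ∨ (s = 9 ∧ 2 ≤ L ∧ L ≤ (k : ℤ) - 2) ∨ (10 ≤ s ∧ L = (k : ℤ) - (12 - s))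

/-- The status of a level represents it. [folklore] -/
theorem repLevel_statusOf (_hk : 5 ≤ k) {L : ℤ} (h0 : 0 ≤ L) (hL : L ≤ k) : RepLevel k (statusOf k L) L := by
  unfold statusOf RepLevel
  split_ifs with h2 h3
  · left; constructor <;> omega
  · right; right; constructor <;> omega
  · right; left; refine ⟨rfl, by omega, by omega⟩

/-- The upper neighbour level of a terminal at level `L` is represented by `nbrStatus (statusOf k L) true`. [folklore] -/
theorem repLevel_nbr_up (hk : 10 ≤ k) {L : ℤ} (h0 : 0 ≤ L) (hL : L + 1 ≤ k) : RepLevel k (Srch.nbrStatus (statusOf k L) true) (L + 1) := by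
  simp only [Srch.nbrStatus, if_true]
  unfold RepLevel statusOf
  split_ifs <;> omega

/-- The lower neighbour level of a terminal at level `L` is represented by `nbrStatus (statusOf k L) false`. [folklore] -/
theorem repLevel_nbr_down (hk : 10 ≤ k) {L : ℤ} (h1 : 1 ≤ L) (hLk : L ≤ k) : RepLevel k (Srch.nbrStatus (statusOf k L) false) (L - 1) := by
  simp only [Srch.nbrStatus, Bool.false_eq_true, if_false]
  unfold RepLevel statusOf
  split_ifs <;> omega

/-- A represented level is pinned by the status unless the status is `9`; two levels represented by one status `≠ 9` coincide. [folklore] -/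
theorem eq_of_repLevel {s L L' : ℤ} (h : RepLevel k s L) (h' : RepLevel k s L') (hs : s ≠ 9) : L = L' := by
  unfold RepLevel at h h'; omega

/-- The meaning of `Srch.inWs`. [folklore] -/
theorem inWs_iff (C : Ctx) (c : Col) (s : ℤ) : Srch.inWs (CtxT.of C) c s = true ↔
    0 ≤ s ∧ s ≤ 12 ∧ Srch.hasLevel C c s = true ∧ inBlkB C.K.tD C.K.sD c = true ∧ C.hasCode c 4 = false ∧ (s = 0 → C.hasCode c 0 = false) ∧
      (s = 1 → C.hasCode c 1 = false) ∧ (s = 11 → C.hasCode c 2 = false) ∧ (s = 12 → C.hasCode c 3 = false) := by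
  unfold Srch.inWs
  simp only [hasCodeT_eq, Bool.and_eq_true, decide_eq_true_eq, Bool.not_eq_true', Bool.or_eq_false_iff, Bool.and_eq_false_iff,
    beq_eq_false_iff_ne, ne_eq]
  constructor
  · rintro ⟨⟨⟨⟨h0, h12⟩, hl⟩, hb⟩, ⟨⟨⟨h4, h5⟩, h6⟩, h7⟩, h8⟩
    exact ⟨h0, h12, hl, hb, h4, fun e => h5.resolve_left (fun h => h e), fun e => h6.resolve_left (fun h => h e),
      fun e => h7.resolve_left (fun h => h e), fun e => h8.resolve_left (fun h => h e)⟩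
  · rintro ⟨h0, h12, hl, hb, h4, h5, h6, h7, h8⟩
    refine ⟨⟨⟨⟨h0, h12⟩, hl⟩, hb⟩, ⟨⟨⟨h4, ?_⟩, ?_⟩, ?_⟩, ?_⟩
    · by_cases e : s = 0
      · exact Or.inr (h5 e)
      · exact Or.inl e
    · by_cases e : s = 1
      · exact Or.inr (h6 e)
      · exact Or.inl e
    · by_cases e : s = 11
      · exact Or.inr (h7 e)
      · exact Or.inl e
    · by_cases e : s = 12
      · exact Or.inr (h8 e)
      · exact Or.inl e

/-- **A vertex of the model cleared set is cleared**: if `inWs C c s` and the film vertex `x` sits over `c` at a level represented by `s`. [folklore] -/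
theorem mem_W_of_inWs {z : Site 2} {K : BKey} (hk : 10 ≤ k) {c : Col} {s : ℤ} (h : Srch.inWs (CtxT.of (Ctx.of K (cls z) (k % 3))) c s = true) {x : slab111 k}
    (hs : sh x = vcol z c) {L : ℤ} (hL : lev (x : Site 3) = L) (hr : RepLevel k s L) : x ∈ Wset k z K.tR K.tD K.sR K.sD := by
  rw [inWs_iff] at h
  obtain ⟨-, -, -, hblk, h4, h0, h1, h11, h12⟩ := h
  have hsx : sh x = z + ![c.1, c.2] := by rw [hs]; rfl
  refine ⟨by rw [hsx]; exact mem_blk_of_inBlkB (by simpa [Ctx.of] using hblk), not_peeled_of_forall hsx fun code hc hm => ?_⟩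
  have hcode := hasCode_iff.2 hc
  rw [hL] at hm
  unfold codeMatches at hm
  unfold RepLevel at hr
  rcases hm with rfl | ⟨rfl, hL0⟩ | ⟨rfl, hL1⟩ | ⟨rfl, hL2⟩ | ⟨rfl, hL3⟩
  · rw [h4] at hcode; exact Bool.false_ne_true hcode
  · rw [h0 (by omega)] at hcode; exact Bool.false_ne_true hcode
  · rw [h1 (by omega)] at hcode; exact Bool.false_ne_true hcode
  · rw [h11 (by omega)] at hcode; exact Bool.false_ne_true hcode
  · rw [h12 (by omega)] at hcode; exact Bool.false_ne_true hcode

/-- **A cleared vertex is in the model cleared set** (at the status representing its level). [folklore] -/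
theorem inWs_of_mem_W {z : Site 2} {K : BKey} (hk : 10 ≤ k) {x : slab111 k} (hx : x ∈ Wset k z K.tR K.tD K.sR K.sD) {c : Col} (hs : sh x = vcol z c)
    {s : ℤ} (hs0 : 0 ≤ s) (hs12 : s ≤ 12) (hr : RepLevel k s (lev (x : Site 3))) : Srch.inWs (CtxT.of (Ctx.of K (cls z) (k % 3))) c s = true := by
  obtain ⟨hblk, hnp⟩ := hx
  have hsx : sh x = z + ![c.1, c.2] := by rw [hs]; rfl
  have hcls := dvd_level_cls hs
  have hkr := Int.emod_emod_of_dvd (k : ℤ) (dvd_refl (3 : ℤ))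
  rw [peeled_iff_codes hsx] at hnp
  have hnot : ∀ code, (Ctx.of K (cls z) (k % 3)).hasCode c code = true → ¬ codeMatches code k (lev (x : Site 3)) :=
    fun code hc hm => hnp ⟨code, hasCode_iff.1 hc, hm⟩
  have hlx : 0 ≤ lev (x : Site 3) ∧ lev (x : Site 3) ≤ k := ⟨(exists_eq_vl x).1.2.1, (exists_eq_vl x).1.2.2⟩
  rw [inWs_iff]
  refine ⟨hs0, hs12, ?_, by rw [hsx] at hblk; simpa [Ctx.of] using inBlkB_of_mem_blk hblk, ?_, ?_, ?_, ?_, ?_⟩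
  · -- class test
    unfold Srch.hasLevel
    unfold RepLevel at hr
    simp only [Ctx.of_c0, Ctx.of_kr]
    split_ifs with h3 h10
    · rw [beq_iff_eq]; omega
    · rw [beq_iff_eq]; push_cast; omega
    · rfl
  · by_contra h4
    rw [Bool.not_eq_false] at h4
    exact hnot 4 h4 (Or.inl rfl)
  all_goals
    intro hs'
    by_contra hc0
    rw [Bool.not_eq_false] at hc0
    refine hnot _ hc0 ?_
    unfold RepLevel at hr; unfold codeMatches; omega

/-- Over the rerouting block as well. [folklore] -/
theorem inWRs_of_mem {z : Site 2} {K : BKey} (hk : 10 ≤ k) {x : slab111 k}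
    (hx : x ∈ Wset k z K.tR K.tD K.sR K.sD ∩ (hexShadow k).lift (blkR 3 z K.tR K.sR)) {c : Col} (hs : sh x = vcol z c)
    {s : ℤ} (hs0 : 0 ≤ s) (hs12 : s ≤ 12) (hr : RepLevel k s (lev (x : Site 3))) : Srch.inWRs (CtxT.of (Ctx.of K (cls z) (k % 3))) c s = true := by
  simp only [Srch.inWRs, Bool.and_eq_true]
  refine ⟨inWs_of_mem_W hk hx.1 hs hs0 hs12 hr, ?_⟩
  have := hx.2
  rw [HexShadow.mem_lift, hexShadow_sh, blkR_three, hs] at this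
  simpa [Ctx.of] using inBlkB_of_mem_blk (z := z) (q := c) this

/-! ## §3 The window and the neighbour columns -/

/-- **The model window test from the real window**, for a column adjacent (in the first coordinate) to a column of the rerouting block: the reduced
`t`-clip `min (cap3 tD) (cap3 tR + 1)` and the capped `s`-clip. [folklore] -/
theorem inWinB_of_inWin {z : Site 2} {tR tD sR : ℕ} {K : BKey} (hKt : K.tD = 3 ∨ ((K.tD : ℤ) = min (tD : ℤ) (tR + 1) ∨ (K.tD : ℤ) = tD))
    (hKs : K.sR = 3 ∨ K.sR = sR) {q c : Col} (hc : c.1 ≤ (tR : ℤ)) (hqc : q.1 ≤ c.1 + 1) (hw : HexShadow.InWin z tD sR (vcol z q)) :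
    Srch.inWinB K q = true := by
  obtain ⟨h1, h2⟩ := hw
  simp only [vcol_apply_zero, vcol_apply_one] at h1 h2
  simp only [Srch.inWinB, Bool.and_eq_true, Bool.or_eq_true, beq_iff_eq, decide_eq_true_eq]
  constructor
  · rcases hKt with h | h | h
    · exact Or.inl h
    · right; rw [h]; exact le_min (by omega) (by omega)
    · right; rw [h]; omega
  · rcases hKs with h | h
    · exact Or.inl h
    · right; rw [h]; omega

/-- Up- and down-neighbour columns of one column are pairwise distinct: `c + u = c + u'` forces `u = u'`, and `c + u ≠ c − u'`. [folklore] -/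
theorem ups_ne_neg {u u' : Col} (hu : u ∈ Srch.ups) (hu' : u' ∈ Srch.ups) {c : Col} : (c.1 + u.1, c.2 + u.2) ≠ (c.1 - u'.1, c.2 - u'.2) := by
  simp only [Srch.ups, List.mem_cons, List.not_mem_nil, or_false] at hu hu'
  intro h
  have h1 := congrArg Prod.fst h; have h2 := congrArg Prod.snd h
  simp only at h1 h2
  rcases hu with rfl | rfl | rfl <;> rcases hu' with rfl | rfl | rfl <;> simp at h1 h2 <;> omega

end Slab111

end Summit.CriticalPhenomena.PercolationContinuityZ3.Theorems.Transplant

end
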